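import Summits.BirchSwinnertonDyer.BirchSwinnertonDyer.Theorems.GoldfeldAllTwistsTwoConverseTwinHalfTraceSevenModEightRankOne
import Summits.BirchSwinnertonDyer.BirchSwinnertonDyer.Theorems.GoldfeldAllTwistsTwoConverseTwinEvenTwistDescent
import Summits.BirchSwinnertonDyer.BirchSwinnertonDyer.Theorems.GoldfeldAllTwistsTwoConverseTwinQuarterTraceTorsion
import Summits.BirchSwinnertonDyer.BirchSwinnertonDyer.Theorems.GoldfeldAllTwistsTwoConverseTwinQuarterTracePartnerQRankOne
import Summits.BirchSwinnertonDyer.BirchSwinnertonDyer.Theorems.GoldfeldAllTwistsTwoConverseTwinPartnerValuesAlphaModFour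
import Summits.BirchSwinnertonDyer.BirchSwinnertonDyer.Theorems.GoldfeldAllTwistsTwoConverseTwinQuarterTracePartnerPHeightModFour
import HarnessLib

set_option linter.dupNamespace false -- namespace `…BirchSwinnertonDyer.BirchSwinnertonDyer…` is the cell's (D-0017 nested layout)
set_option autoImplicit false

/-!
# C7A tranche P (RULING (ccclx)): `…QuarterTracePartnerQRankOne` ((RO⁗_q) and the χ_q two-point lemma, type α: rank `49a1^{(2p)} = 0` via P0) — hp4-GENERIC type-α twin (`p ≡ 1 (mod 4)`; C4 = `p ≡ 5 (8)` landed original, C7A = `p ≡ 1 (8)` new),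
# partner valuations through the P0 wrappers `…_alpha_modFour` / `…_modFour`

Cell `bsd-goldfeld`, seat `bsd-goldfeld-s1p-c3x` (gen 13). MECHANICAL TWIN (generator `work/twingen.py`, mirror ROUTE-S1PLUS/c7a-c3xg13/): statements letter-identical to
the source's except `hp8 : p % 8 = 5` ↦ `hp4 : p % 4 = 1` (+ `hα` where the type-α valuation of `49a1^{(2p)}` is consumed), theorem names `+_modFourAlpha`, and the
D2/P0 lemma names (K4 of (ccclx)). `--supports stmt-BirchSwinnertonDyer-20044` as a HELPER. Theses-free; theorems only; no definition, no new fact, no `sorry`.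
Binders BY NAME as in the source. FRONTIER-grade: density-zero sub-families modulo named print; never distance-to-summit. HONEST FRAMING: items 19140 / 20044
unchanged; BSD is not proved by any of this.
-/

noncomputable section

open scoped Classical IntermediateField

open WeierstrassCurve Literature.NumberTheory.EllipticCurves
  Literature.NumberTheory.EllipticCurves.ModularForms Literature.NumberTheory.EllipticCurves.CoatesLiTianZhai2015

namespace Summit.BirchSwinnertonDyer.BirchSwinnertonDyer.Theorems.GoldfeldGoodTwists

-- One decidability world for all point groups (ℚ, K, K⟮r₀⟯, L), exactly as in A″'s `…SevenModEightRankOne`; file-local.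
attribute [local instance 2000] Classical.propDecidable

/-! ## §2 The `K/ℚ` step: `V₁ = (49a1^{(−q)})^{(1)}`, `V₁^{(d_K)} ≅ 49a1^{(2p)}` has only torsion `ℚ`-points -/

section RatStepNegEightTwoPrimes

/-- **Every `ℚ`-point of `(49a1^{(−q)})^{(−8qp)} = 49a1^{(8q²p)} ≅ 49a1^{(2p)}` is torsion** (`q ≠ 0`; `p ≡ 1 (mod 4)` prime with
`(−7/p) = +1`): rank `0` of `cm7^{(2p)}` by LINE C3's fact-free `2`-isogeny descent `rank_eq_zero_and_sha_two_twoPosTwist_alpha_modFour`. TYPE α (`−7` NOT a fourth power mod `p`, hypothesis `hα`): the rank-`0` / `Ш[2] = 0` / `ord₂ L^{alg} = 3` inputs for `49a1^{(2p)}` enter through the P0 wrappers `rank_eq_zero_and_sha_two_twoPosTwist_alpha_modFour` / `lValue_twoPosTwist_mul_sqrt_alpha_modFour` (`…TwinPartnerValuesAlphaModFour`), valid for every `p ≡ 1 (mod 4)` of type α (at `p ≡ 1 (8)` type β the partner is NOT `2`-minimal — cell C7).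
[cite: SilvermanAEC2009, X.4.2(a), X.5 Cor. 5.4] -/
theorem isOfFinAddOrder_point_twist_negPrime_negEightTwoPrimes_modFourAlpha {q p : ℕ} [Fact p.Prime] (hp4 : p % 4 = 1)
    (hp7 : legendreSym p (-7) = 1) (hα : ¬ ∃ x : ZMod p, x ^ 4 = -7) (hq : q ≠ 0)
    (P : ((cm7.quadraticTwist (-(q : ℚ))).quadraticTwist (-(8 * (q : ℚ) * p))).toAffine.Point) : IsOfFinAddOrder P := by
  have hp : p.Prime := Fact.out
  have h2p : (((2 * (p : ℤ) : ℤ)) : ℚ) ≠ 0 := by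
    push_cast
    exact mul_ne_zero two_ne_zero (by exact_mod_cast hp.ne_zero)
  haveI : (cm7.quadraticTwist (((2 * (p : ℤ) : ℤ)) : ℚ)).IsElliptic := cm7.isElliptic_quadraticTwist h2p
  have hr0 := (rank_eq_zero_and_sha_two_twoPosTwist_alpha_modFour hp4 hp7 hα (cm7.quadraticTwist (((2 * (p : ℤ) : ℤ)) : ℚ)) 1
    (one_smul _ _)).1
  haveI : Finite (cm7.quadraticTwist (((2 * (p : ℤ) : ℤ)) : ℚ)).toAffine.Point :=
    (cm7.quadraticTwist (((2 * (p : ℤ) : ℤ)) : ℚ)).mordellWeilRank_eq_zero_iff_finite.mp hr0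
  have h2q : (2 * (q : ℚ)) ≠ 0 := mul_ne_zero two_ne_zero (by exact_mod_cast hq)
  obtain ⟨C, hC⟩ := cm7.exists_variableChange_quadraticTwist_mul_sq (((2 * (p : ℤ) : ℤ)) : ℚ) (2 * (q : ℚ)) h2q
  let e : ((cm7.quadraticTwist (-(q : ℚ))).quadraticTwist (-(8 * (q : ℚ) * p))).toAffine.Point ≃+
      (cm7.quadraticTwist (((2 * (p : ℤ) : ℤ)) : ℚ)).toAffine.Point :=
    ((Affine.Point.congrEquiv (quadraticTwist_negPrime_quadraticTwist_negEightTwoPrimes q p)).trans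
      (Affine.Point.congrEquiv hC.symm)).trans (VariableChange.pointEquiv (cm7.quadraticTwist _) C).symm
  simpa using e.symm.toAddMonoidHom.isOfFinAddOrder (isOfFinAddOrder_of_finite (e P))

variable {K : Type} [Field K] [NumberField K]

/-- **The `K/ℚ` step (family `d_K = −8qp`)**: `V₁ = (cm7^{(−q)})^{(1)}`; granted CLTZ15 Thm. 1.4 by name (`h14`) there is `g ∈ V₁(ℚ)`
with `2P − m • ι(g) ∈ tors` for EVERY `P ∈ V₁(K)` and some `m` (`2P = (P + σP) + (P − σP)`: the first summand is `≡ m•g` along a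
rank-one Mordell–Weil basis, the second is a twist of a `ℚ`-point of `V₁^{(d_K)} ≅ 49a1^{(2p)}`, torsion by LINE C3). TYPE α (`−7` NOT a fourth power mod `p`, hypothesis `hα`): the rank-`0` / `Ш[2] = 0` / `ord₂ L^{alg} = 3` inputs for `49a1^{(2p)}` enter through the P0 wrappers `rank_eq_zero_and_sha_two_twoPosTwist_alpha_modFour` / `lValue_twoPosTwist_mul_sqrt_alpha_modFour` (`…TwinPartnerValuesAlphaModFour`), valid for every `p ≡ 1 (mod 4)` of type α (at `p ≡ 1 (8)` type β the partner is NOT `2`-minimal — cell C7).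
[cite: CoatesLiTianZhai2015, Thm. 1.4 (p. 360)] [cite: SilvermanAEC2009, X.2 Prop. 2.4, Exercise 10.16 and Thm. VIII.6.7] -/
theorem exists_two_zsmul_sub_incl_negEightTwoPrimes_modFourAlpha (h14 : thm14_rankOne_twist) (hK : IsImaginaryQuadratic K)
    {q p : ℕ} (hq : q.Prime) (h3 : 3 < q) (hq4 : q % 4 = 3) (hq7 : jacobiSym q 7 = -1) [Fact p.Prime] (hp4 : p % 4 = 1)
    (hp7 : legendreSym p (-7) = 1) (hα : ¬ ∃ x : ZMod p, x ^ 4 = -7) (hdK : NumberField.discr K = -(8 * (q : ℤ) * p)) :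
    ∃ g : ((cm7.quadraticTwist (-(q : ℚ))).quadraticTwist 1).toAffine.Point,
      ∀ P : (((cm7.quadraticTwist (-(q : ℚ))).quadraticTwist 1).baseChange K).toAffine.Point,
        ∃ m : ℤ, IsOfFinAddOrder ((2 : ℤ) • P -
          m • QuadraticDescent.incl K ((cm7.quadraticTwist (-(q : ℚ))).quadraticTwist 1) g) := by
  haveI := isElliptic_twist_negPrime_one (l := q) hq.ne_zero
  obtain ⟨B, hB⟩ := exists_isMordellWeilBasis_fin_one _ (mordellWeilRank_twist_negPrime_one h14 hq h3 hq4 hq7)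
  refine ⟨B 0, fun P => ?_⟩
  obtain ⟨δ, hδ, hδK, -⟩ := exists_sq_eq_discr_and_span hK
  have hθ : δ ∉ Set.range (algebraMap ℚ K) := by rintro ⟨a, ha⟩; exact hδK a ha
  have hσσ : ∀ z, Literature.NumberTheory.QuadraticFields.Quadratic.conj hK.1 hθ hδ
      (Literature.NumberTheory.QuadraticFields.Quadratic.conj hK.1 hθ hδ z) = z :=
    Literature.NumberTheory.QuadraticFields.Quadratic.conj_conj hK.1 hθ hδ
  -- the `σ`-fixed part comes from `V₁(ℚ)`
  obtain ⟨Q, hQ⟩ : ∃ Q : ((cm7.quadraticTwist (-(q : ℚ))).quadraticTwist 1).toAffine.Point,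
      QuadraticDescent.incl K ((cm7.quadraticTwist (-(q : ℚ))).quadraticTwist 1) Q =
      P + QuadraticDescent.conjMap ((cm7.quadraticTwist (-(q : ℚ))).quadraticTwist 1)
        (Literature.NumberTheory.QuadraticFields.Quadratic.conj hK.1 hθ hδ) P :=
    exists_incl_eq_of_conjMap_eq ((cm7.quadraticTwist (-(q : ℚ))).quadraticTwist 1) hK.1 hθ hδ (by
      rw [map_add, QuadraticDescent.conjMap_conjMap ((cm7.quadraticTwist (-(q : ℚ))).quadraticTwist 1) hσσ, add_comm])
  -- the `σ`-anti-fixed part comes from the twist by `d_K`, all of whose `ℚ`-points are torsion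
  obtain ⟨R, hR⟩ : ∃ R : ((cm7.quadraticTwist (-(q : ℚ))).quadraticTwist (NumberField.discr K : ℚ)).toAffine.Point,
      QuadraticDescent.twistMap (cm7.quadraticTwist (-(q : ℚ))) hθ hδ R =
        P - QuadraticDescent.conjMap ((cm7.quadraticTwist (-(q : ℚ))).quadraticTwist 1)
          (Literature.NumberTheory.QuadraticFields.Quadratic.conj hK.1 hθ hδ) P :=
    exists_twistMap_eq_of_conjMap_eq_neg (cm7.quadraticTwist (-(q : ℚ))) hK.1 hθ hδ (by
      rw [map_sub, QuadraticDescent.conjMap_conjMap ((cm7.quadraticTwist (-(q : ℚ))).quadraticTwist 1) hσσ, neg_sub])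
  have hRt : IsOfFinAddOrder R := by
    have hc : (NumberField.discr K : ℚ) = -(8 * (q : ℚ) * p) := by rw [hdK]; push_cast; ring
    have e := Affine.Point.congrEquiv (congrArg (cm7.quadraticTwist (-(q : ℚ))).quadraticTwist hc)
    have h := isOfFinAddOrder_point_twist_negPrime_negEightTwoPrimes_modFourAlpha hp4 hp7 hα hq.ne_zero (e R)
    simpa using e.symm.toAddMonoidHom.isOfFinAddOrder h
  -- `Q ≡ m • g` along the basis
  obtain ⟨m, hm⟩ := exists_sub_zsmul_isOfFinAddOrder_of_isMordellWeilBasis hB Q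
  refine ⟨m, ?_⟩
  have e2 : (P + QuadraticDescent.conjMap ((cm7.quadraticTwist (-(q : ℚ))).quadraticTwist 1)
        (Literature.NumberTheory.QuadraticFields.Quadratic.conj hK.1 hθ hδ) P) +
      (P - QuadraticDescent.conjMap ((cm7.quadraticTwist (-(q : ℚ))).quadraticTwist 1)
        (Literature.NumberTheory.QuadraticFields.Quadratic.conj hK.1 hθ hδ) P) = (2 : ℤ) • P := by
    abel
  have hdec : (2 : ℤ) • P - m • QuadraticDescent.incl K ((cm7.quadraticTwist (-(q : ℚ))).quadraticTwist 1) (B 0) =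
      QuadraticDescent.incl K ((cm7.quadraticTwist (-(q : ℚ))).quadraticTwist 1) (Q - m • B 0) +
        QuadraticDescent.twistMap (cm7.quadraticTwist (-(q : ℚ))) hθ hδ R := by
    rw [← e2, ← hQ, hR, map_sub, map_zsmul]
    abel
  rw [hdec]
  exact isOfFinAddOrder_add'
    ((QuadraticDescent.incl K ((cm7.quadraticTwist (-(q : ℚ))).quadraticTwist 1)).isOfFinAddOrder hm)
    ((QuadraticDescent.twistMap _ hθ hδ).isOfFinAddOrder hRt)

end RatStepNegEightTwoPrimes

/-! ## §3 (RO⁗_q) — the `χ_q`-part of `X₀(49)(L)` has rank at most one -/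

section ChiPartRankOne

variable {K : Type} [Field K] [NumberField K] {L : Type*} [Field L] [CharZero L] [Algebra K L]
  [FiniteDimensional K L] [IsGalois K L]

/-- Torsion is closed under subtraction (local helper). [folklore] -/
private theorem tors_sub'_modFourAlpha {A : Type*} [AddCommGroup A] {a b : A} (ha : IsOfFinAddOrder a) (hb : IsOfFinAddOrder b) :
    IsOfFinAddOrder (a - b) := by rw [← AddCommGroup.mem_torsion] at ha hb ⊢; exact sub_mem ha hb

/-- If `2 • u` has finite order then so has `u` (local helper). [folklore] -/
private theorem tors_of_two_zsmul'_modFourAlpha {A : Type*} [AddCommGroup A] {u : A} (h : IsOfFinAddOrder ((2 : ℤ) • u)) :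
    IsOfFinAddOrder u := by
  obtain ⟨n, hn, hnu⟩ := (isOfFinAddOrder_iff_zsmul_eq_zero).mp h
  exact (isOfFinAddOrder_iff_zsmul_eq_zero).mpr ⟨n * 2, mul_ne_zero hn two_ne_zero, by rw [mul_smul, hnu]⟩

/-- **(RO⁗_q) — THE `χ_q`-PART OF `X₀(49)(L)` HAS RANK AT MOST ONE (family `d_K = −8qp`)**: `q > 3` prime, `q ≡ 3 (mod 4)`,
`(q/7) = −1`; `p ≡ 1 (mod 4)` prime, `(−7/p) = +1`; `L/K` finite Galois, `r₀² = −q`; granted CLTZ15 Thm. 1.4 by name (`h14`), two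
`χ_q`-points `Z₁, Z₂ ∈ X₀(49)(L)`, `Z₂` of infinite order, have `a•Z₁ − b•Z₂ ∈ tors` for some `a ≠ 0`, `b` (`Z₁ = P_q`, `Z₂ = 2Y − T`). TYPE α (`−7` NOT a fourth power mod `p`, hypothesis `hα`): the rank-`0` / `Ш[2] = 0` / `ord₂ L^{alg} = 3` inputs for `49a1^{(2p)}` enter through the P0 wrappers `rank_eq_zero_and_sha_two_twoPosTwist_alpha_modFour` / `lValue_twoPosTwist_mul_sqrt_alpha_modFour` (`…TwinPartnerValuesAlphaModFour`), valid for every `p ≡ 1 (mod 4)` of type α (at `p ≡ 1 (8)` type β the partner is NOT `2`-minimal — cell C7).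
[cite: CoatesLiTianZhai2015, Thm. 1.4 (p. 360) and (2.8)] [cite: SilvermanAEC2009, X.2 Prop. 2.4, Exercise 10.16] [cite: Gross1984, §§4–5] -/
theorem exists_zsmul_sub_zsmul_isOfFinAddOrder_of_isChiPoint_negEightTwoPrimes_modFourAlpha (h14 : thm14_rankOne_twist)
    (hK : IsImaginaryQuadratic K) {q p : ℕ} (hq : q.Prime) (h3 : 3 < q) (hq4 : q % 4 = 3) (hq7 : jacobiSym q 7 = -1)
    [Fact p.Prime] (hp4 : p % 4 = 1) (hp7 : legendreSym p (-7) = 1) (hα : ¬ ∃ x : ZMod p, x ^ 4 = -7)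
    (hdK : NumberField.discr K = -(8 * (q : ℤ) * p)) {r₀ : L} (hr : r₀ ^ 2 = algebraMap K L (-(q : K)))
    (Z₁ Z₂ : (cm7.baseChange L).toAffine.Point)
    (h₁fix : ∀ σ : L ≃ₐ[K] L, σ r₀ = r₀ → Affine.Point.map (σ : L →ₐ[K] L) Z₁ = Z₁)
    (h₁neg : ∀ σ : L ≃ₐ[K] L, σ r₀ = -r₀ → Affine.Point.map (σ : L →ₐ[K] L) Z₁ = -Z₁)
    (h₂fix : ∀ σ : L ≃ₐ[K] L, σ r₀ = r₀ → Affine.Point.map (σ : L →ₐ[K] L) Z₂ = Z₂)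
    (h₂neg : ∀ σ : L ≃ₐ[K] L, σ r₀ = -r₀ → Affine.Point.map (σ : L →ₐ[K] L) Z₂ = -Z₂)
    (hZ₂ : ¬ IsOfFinAddOrder Z₂) :
    ∃ a b : ℤ, a ≠ 0 ∧ IsOfFinAddOrder (a • Z₁ - b • Z₂) := by
  have hp : p.Prime := Fact.out
  have hp2 : p ≠ 2 := by rintro rfl; norm_num at hp4
  have hfin := finrank_genusField_negEightTwoPrimes hK hq hp hp2 hdK hr
  have hθ := gen_not_mem_range_negEightTwoPrimes hK hq hp hp2 hdK hr
  have hi := gen_sq_negEightPrime (K := K) hr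
  obtain ⟨z₁, hz₁, hanti₁⟩ := exists_descent_of_isChiPoint_negEightPrime hfin hθ hi Z₁ h₁fix h₁neg
  obtain ⟨z₂, hz₂, hanti₂⟩ := exists_descent_of_isChiPoint_negEightPrime hfin hθ hi Z₂ h₂fix h₂neg
  -- re-read the default-world statements in this file's instance world
  have hz₁' : Affine.Point.map (W' := cm7) (algebraMap K⟮r₀⟯ L).toRatAlgHom z₁ = Z₁ := by
    rw [← hz₁]; rcases z₁ with _ | ⟨x, y, hxy⟩ <;> rfl
  have hz₂' : Affine.Point.map (W' := cm7) (algebraMap K⟮r₀⟯ L).toRatAlgHom z₂ = Z₂ := by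
    rw [← hz₂]; rcases z₂ with _ | ⟨x, y, hxy⟩ <;> rfl
  have hanti₁' : Affine.Point.map (W' := cm7)
      (Literature.NumberTheory.QuadraticFields.Quadratic.conj hfin hθ hi) z₁ = -z₁ := by
    rcases z₁ with _ | ⟨x, y, hxy⟩ <;> [rfl; exact hanti₁]
  have hanti₂' : Affine.Point.map (W' := cm7)
      (Literature.NumberTheory.QuadraticFields.Quadratic.conj hfin hθ hi) z₂ = -z₂ := by
    rcases z₂ with _ | ⟨x, y, hxy⟩ <;> [rfl; exact hanti₂]
  -- the completing-square transport `e : X₀(49)(K⟮r₀⟯) ≃ (cm7 ⊗ K)^{(1)}(K⟮r₀⟯)`, natural in `Gal(K⟮r₀⟯/K)` (A″ verbatim)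
  have hbb : (cm7.baseChange K).baseChange K⟮r₀⟯ = cm7.baseChange K⟮r₀⟯ :=
    cm7.map_baseChange (IsScalarTower.toAlgHom ℚ K K⟮r₀⟯)
  have hC := completeSquare_smul_cm7_baseChange K
  let e₀ : (cm7.baseChange K⟮r₀⟯).toAffine.Point ≃+ ((cm7.baseChange K).baseChange K⟮r₀⟯).toAffine.Point :=
    Affine.Point.congrEquiv hbb.symm
  let e₁ := VariableChange.pointEquivBaseChange (cm7.baseChange K)
    (((⟨1, 0, -(1 / 2 : ℚ), 0⟩ : VariableChange ℚ).map (algebraMap ℚ K))) K⟮r₀⟯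
  let e₂ := Affine.Point.congrEquiv (congrArg (fun X : WeierstrassCurve K => X.baseChange K⟮r₀⟯) hC)
  let e := e₀.trans (e₁.trans e₂)
  have hσ : ∀ P : (cm7.baseChange K⟮r₀⟯).toAffine.Point,
      Affine.Point.map (W' := (cm7.baseChange K).quadraticTwist 1)
          (Literature.NumberTheory.QuadraticFields.Quadratic.conj hfin hθ hi) (e P) =
        e (Affine.Point.map (W' := cm7) (Literature.NumberTheory.QuadraticFields.Quadratic.conj hfin hθ hi) P) := by
    intro P
    have h0 : ∀ Q : (cm7.baseChange K⟮r₀⟯).toAffine.Point,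
        Affine.Point.map (W' := cm7.baseChange K)
            (Literature.NumberTheory.QuadraticFields.Quadratic.conj hfin hθ hi) (e₀ Q) =
          e₀ (Affine.Point.map (W' := cm7) (Literature.NumberTheory.QuadraticFields.Quadratic.conj hfin hθ hi) Q) := by
      intro Q
      rcases Q with _ | ⟨x, y, hxy⟩
      · simp [e₀, Affine.Point.congrEquiv_zero, ← Affine.Point.zero_def]
      · simp only [e₀, Affine.Point.congrEquiv_some, Affine.Point.map_some]
    show Affine.Point.map _ (e₂ (e₁ (e₀ P))) = e₂ (e₁ (e₀ (Affine.Point.map _ P)))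
    rw [← h0, ← VariableChange.pointEquivBaseChange_map]
    exact map_congrEquiv_baseChange hC _ _
  have hanti : ∀ z : (cm7.baseChange K⟮r₀⟯).toAffine.Point,
      Affine.Point.map (W' := cm7) (Literature.NumberTheory.QuadraticFields.Quadratic.conj hfin hθ hi) z = -z →
      QuadraticDescent.conjMap ((cm7.baseChange K).quadraticTwist 1)
        (Literature.NumberTheory.QuadraticFields.Quadratic.conj hfin hθ hi) (e z) = -(e z) := by
    intro z hz
    have h1 := hσ z
    rw [hz, map_neg] at h1
    exact h1
  -- both points are twists of `K`-points of the partner `(cm7 ⊗ K)^{(−q)}`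
  obtain ⟨R₁, hR₁⟩ := exists_twistMap_eq_of_conjMap_eq_neg (cm7.baseChange K) hfin hθ hi (hanti z₁ hanti₁')
  obtain ⟨R₂, hR₂⟩ := exists_twistMap_eq_of_conjMap_eq_neg (cm7.baseChange K) hfin hθ hi (hanti z₂ hanti₂')
  let κ : ((cm7.baseChange K).quadraticTwist (-(q : K))).toAffine.Point ≃+
      ((((cm7.quadraticTwist (-(q : ℚ))).quadraticTwist 1)).baseChange K).toAffine.Point :=
    Affine.Point.congrEquiv (cm7_baseChange_quadraticTwist_negPrime K q)
  -- the `K/ℚ` step (§2)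
  obtain ⟨g, hg⟩ := exists_two_zsmul_sub_incl_negEightTwoPrimes_modFourAlpha h14 hK hq h3 hq4 hq7 hp4 hp7 hα hdK
  obtain ⟨m₁, hm₁⟩ := hg (κ R₁)
  obtain ⟨m₂, hm₂⟩ := hg (κ R₂)
  -- `m₂ ≠ 0` since `Z₂` has infinite order
  have hm₂0 : m₂ ≠ 0 := by
    rintro rfl
    apply hZ₂
    rw [zero_smul, sub_zero] at hm₂
    have hR₂t : IsOfFinAddOrder R₂ := by
      have h := κ.symm.toAddMonoidHom.isOfFinAddOrder hm₂
      rw [map_zsmul, AddEquiv.coe_toAddMonoidHom, AddEquiv.symm_apply_apply] at h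
      exact tors_of_two_zsmul'_modFourAlpha h
    have hz₂t : IsOfFinAddOrder z₂ := by
      have h := (QuadraticDescent.twistMap (cm7.baseChange K) hθ hi).isOfFinAddOrder hR₂t
      rw [hR₂] at h
      simpa using e.symm.toAddMonoidHom.isOfFinAddOrder h
    rw [← hz₂']
    exact (Affine.Point.map (W' := cm7) (algebraMap K⟮r₀⟯ L).toRatAlgHom).isOfFinAddOrder hz₂t
  -- the relation `m₂•(2κR₁) − m₁•(2κR₂) ∈ tors`, pushed back to `L`
  refine ⟨2 * m₂, 2 * m₁, mul_ne_zero two_ne_zero hm₂0, ?_⟩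
  have hrel : IsOfFinAddOrder (m₂ • ((2 : ℤ) • κ R₁) - m₁ • ((2 : ℤ) • κ R₂)) := by
    have eq : m₂ • ((2 : ℤ) • κ R₁) - m₁ • ((2 : ℤ) • κ R₂) =
        m₂ • ((2 : ℤ) • κ R₁ - m₁ • QuadraticDescent.incl K _ g) -
          m₁ • ((2 : ℤ) • κ R₂ - m₂ • QuadraticDescent.incl K _ g) := by
      rw [smul_sub, smul_sub, smul_smul m₂ m₁, smul_smul m₁ m₂, mul_comm m₁ m₂]
      abel
    rw [eq]
    exact tors_sub'_modFourAlpha (isOfFinAddOrder_zsmul m₂ hm₁) (isOfFinAddOrder_zsmul m₁ hm₂)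
  have h1 : IsOfFinAddOrder (m₂ • ((2 : ℤ) • R₁) - m₁ • ((2 : ℤ) • R₂)) := by
    have h := κ.symm.toAddMonoidHom.isOfFinAddOrder hrel
    simpa using h
  have h2 : IsOfFinAddOrder (m₂ • ((2 : ℤ) • e z₁) - m₁ • ((2 : ℤ) • e z₂)) := by
    have h := (QuadraticDescent.twistMap (cm7.baseChange K) hθ hi).isOfFinAddOrder h1
    rw [map_sub, map_zsmul, map_zsmul, map_zsmul, map_zsmul, hR₁, hR₂] at h
    exact h
  have h3' : IsOfFinAddOrder (m₂ • ((2 : ℤ) • z₁) - m₁ • ((2 : ℤ) • z₂)) := by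
    have h := e.symm.toAddMonoidHom.isOfFinAddOrder h2
    simpa using h
  have h4 := (Affine.Point.map (W' := cm7) (algebraMap K⟮r₀⟯ L).toRatAlgHom).isOfFinAddOrder h3'
  rw [map_sub, map_zsmul, map_zsmul, map_zsmul, map_zsmul, hz₁', hz₂'] at h4
  rw [mul_comm (2 : ℤ) m₂, mul_comm (2 : ℤ) m₁, ← smul_smul, ← smul_smul]
  exact h4

end ChiPartRankOne

end Summit.BirchSwinnertonDyer.BirchSwinnertonDyer.Theorems.GoldfeldGoodTwists

end
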